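import Literature.RepresentationTheory.TwistedCoinvariants
import Mathlib.LinearAlgebra.TensorProduct.RightExactness
import HarnessLib

/-!
# Coinvariants of a diagonal tensor product: the see-saw quotient onto the tensor of the factors' coinvariants

For a commutative ring `k`, a group `H`, `H`-representations `ρ₁` on `S₁` and `ρ₂` on `S₂`, and characters
`χ ψ : H →* kˣ` (tree currency `TwistedCoinv.Coinv`/`mk`/`rep` of `TwistedCoinvariants.lean`).  KERNEL ONLY:
theorems and two `def`s with body (`coinvTprodQuot`, `coinvTprodQuotKerEquiv`); no named fact.

§1 The quotient map (label by label):
* `coinvTprodQuot ρ₁ ρ₂ χ ψ : Coinv (ρ₁.tprod ρ₂) χ →ₗ[k] Coinv ρ₁ ψ ⊗[k] Coinv ρ₂ (χ * ψ⁻¹)`, `mk (v ⊗ e) ↦ mk v ⊗ mk e`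
  (well defined because `χ = ψ · (χψ⁻¹)`); `coinvTprodQuot_mk_tmul`, `coinvTprodQuot_comp_mk`, `coinvTprodQuot_surjective`;
* `commute_tprod_one` — `σ ⊗ 1` commutes with `ρ₁ ⊗ ρ₂` when `σ` commutes with `ρ₁`;
* `coinvTprodQuot_rep` — `G`-equivariance: `coinvTprodQuot ∘ rep χ (σ ⊗ 1) = (rep ψ σ ⊗ 1) ∘ coinvTprodQuot`;
* `coinvTprodQuot_universal` — a `k`-linear map out of `Coinv (ρ₁ ⊗ ρ₂) χ` on which `ρ₁(h) ⊗ 1` acts by `ψ(h)`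
  factors uniquely through `coinvTprodQuot`.

§2 Its kernel:
* `ker_coinvTprodQuot` — `ker (coinvTprodQuot …) = (ker (ρ₁.tprod 1) ψ).map mk`: the `(ρ₁ ⊗ 1, ψ)`-relation
  submodule of `S₁ ⊗ S₂` read in the `χ`-coinvariants;
* `ker_map_mk_mk` — upstairs, `ker (mk ⊗ mk) = ker (ρ₁.tprod ρ₂) χ ⊔ ker (ρ₁.tprod 1) ψ`;
* `coinvTprodQuotKerEquiv` — the induced isomorphism
  `Coinv (ρ₁.tprod ρ₂) χ ⧸ (ker (ρ₁.tprod 1) ψ).map mk ≃ₗ[k] Coinv ρ₁ ψ ⊗[k] Coinv ρ₂ (χ * ψ⁻¹)` and its values on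
  generators;
* `range_rTensor_subtype_ker`, `range_lTensor_subtype_ker` — the one-sided relation submodules are the images of
  `(ker ρ₁ ψ) ⊗ S₂` and `S₁ ⊗ (ker ρ₂ φ)`;
* `ker_tprod_sup_ker_tprod_one` — `ker (ρ₁.tprod ρ₂) χ ⊔ ker (ρ₁.tprod 1) ψ = ker (ρ₁.tprod 1) ψ ⊔ ker (1.tprod ρ₂) (χψ⁻¹)`
  (right-exactness of `⊗`, Mathlib `TensorProduct.map_ker`).

This is the see-saw bookkeeping of [Liu2021, proof of Thm. 4.15, l. 2199–2212] (the `χ`-coinvariants of a tensor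
product of Weil representations under the diagonal `U(W)`, cf. [GelbartRogawski1991, §3.1]) in the abstract
coinvariant currency of [Liu2021, App. D §D.1 Step 3].

## References
* [Liu2021] Y. Liu, *Fourier–Jacobi cycles and arithmetic relative trace formula*, Camb. J. Math. 9 (2021): proof of
  Thm. 4.15 (l. 2199–2212), App. D §D.1 Step 3 (l. 5219).
* [GelbartRogawski1991] S. Gelbart, J. Rogawski, *L-functions and Fourier–Jacobi coefficients for the unitary group
  U(3)*, Invent. Math. 105 (1991), §3.1 (see-saw duality), pp. 454–457.
-/

set_option autoImplicit false

noncomputable section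

open scoped TensorProduct

namespace Literature.RepresentationTheory.TwistedCoinv

variable {k : Type*} [CommRing k] {G H S₁ S₂ : Type*} [Group G] [Group H]
  [AddCommGroup S₁] [Module k S₁] [AddCommGroup S₂] [Module k S₂]
  (ρ₁ : Representation k H S₁) (ρ₂ : Representation k H S₂) (χ ψ : H →* kˣ)

/-- the character identity `ψ h · (χ ψ⁻¹) h = χ h` in `k`. [cite: Liu2021, App. D §D.1 Step 3 (l. 5219)] -/
theorem coe_mul_coe_mul_inv_apply (h : H) :
    ((ψ h : kˣ) : k) * (((χ * ψ⁻¹) h : kˣ) : k) = ((χ h : kˣ) : k) := by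
  rw [← Units.val_mul, MonoidHom.mul_apply, MonoidHom.inv_apply, mul_comm, inv_mul_cancel_right]

/-- the generator map `v ⊗ e ↦ mk v ⊗ mk e` transforms under the diagonal `H` by `χ`.
[cite: Liu2021, App. D §D.1 Step 3 (l. 5219)] -/
theorem map_mk_mk_tprod (h : H) (x : S₁ ⊗[k] S₂) :
    TensorProduct.map (mk ρ₁ ψ) (mk ρ₂ (χ * ψ⁻¹)) ((ρ₁.tprod ρ₂) h x) =
      ((χ h : kˣ) : k) • TensorProduct.map (mk ρ₁ ψ) (mk ρ₂ (χ * ψ⁻¹)) x := by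
  have h₁ : mk ρ₁ ψ ∘ₗ ρ₁ h = ((ψ h : kˣ) : k) • mk ρ₁ ψ := LinearMap.ext fun v => mk_ρW ρ₁ ψ h v
  have h₂ : mk ρ₂ (χ * ψ⁻¹) ∘ₗ ρ₂ h = (((χ * ψ⁻¹) h : kˣ) : k) • mk ρ₂ (χ * ψ⁻¹) :=
    LinearMap.ext fun e => mk_ρW ρ₂ (χ * ψ⁻¹) h e
  rw [Representation.tprod_apply, ← LinearMap.comp_apply, ← TensorProduct.map_comp, h₁, h₂,
    TensorProduct.map_smul_left, TensorProduct.map_smul_right, LinearMap.smul_apply, LinearMap.smul_apply, smul_smul,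
    coe_mul_coe_mul_inv_apply]

/-- **`q_ψ : Coinv (ρ₁ ⊗ ρ₂) χ → Coinv ρ₁ ψ ⊗ Coinv ρ₂ (χψ⁻¹)`**, `mk (v ⊗ e) ↦ mk v ⊗ mk e` — the see-saw quotient of the
`χ`-coinvariants of a diagonal tensor product onto the tensor of the factors' coinvariants at a pair of labels with
product `χ`. [cite: Liu2021, proof of Thm. 4.15 (l. 2199–2212); App. D §D.1 Step 3 (l. 5219)] -/
def coinvTprodQuot : Coinv (ρ₁.tprod ρ₂) χ →ₗ[k] Coinv ρ₁ ψ ⊗[k] Coinv ρ₂ (χ * ψ⁻¹) :=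
  lift (ρ₁.tprod ρ₂) χ (TensorProduct.map (mk ρ₁ ψ) (mk ρ₂ (χ * ψ⁻¹))) (map_mk_mk_tprod ρ₁ ρ₂ χ ψ)

/-- value on generators: `q_ψ (mk (v ⊗ e)) = mk v ⊗ mk e`. [cite: Liu2021, App. D §D.1 Step 3 (l. 5219)] -/
@[simp] theorem coinvTprodQuot_mk_tmul (v : S₁) (e : S₂) :
    coinvTprodQuot ρ₁ ρ₂ χ ψ (mk (ρ₁.tprod ρ₂) χ (v ⊗ₜ[k] e)) = mk ρ₁ ψ v ⊗ₜ[k] mk ρ₂ (χ * ψ⁻¹) e := by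
  rw [coinvTprodQuot, lift_mk, TensorProduct.map_tmul]

/-- `q_ψ ∘ mk = mk ⊗ mk`. [cite: Liu2021, App. D §D.1 Step 3 (l. 5219)] -/
theorem coinvTprodQuot_comp_mk :
    coinvTprodQuot ρ₁ ρ₂ χ ψ ∘ₗ mk (ρ₁.tprod ρ₂) χ = TensorProduct.map (mk ρ₁ ψ) (mk ρ₂ (χ * ψ⁻¹)) :=
  lift_comp_mk _ _ _ _

/-- **`q_ψ` is onto.** [cite: Liu2021, App. D §D.1 Step 3 (l. 5219)] -/
theorem coinvTprodQuot_surjective : Function.Surjective (coinvTprodQuot ρ₁ ρ₂ χ ψ) := by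
  intro y
  obtain ⟨x, rfl⟩ := TensorProduct.map_surjective (mk_surjective ρ₁ ψ) (mk_surjective ρ₂ (χ * ψ⁻¹)) y
  exact ⟨mk (ρ₁.tprod ρ₂) χ x, by rw [← LinearMap.comp_apply, coinvTprodQuot_comp_mk]⟩

/-- `σ ⊗ 1` commutes with the diagonal `ρ₁ ⊗ ρ₂` when `σ` commutes with `ρ₁` (the acting group of the first factor).
[cite: GelbartRogawski1991, §3.1 p. 454] -/
theorem commute_tprod_one (σ : Representation k G S₁) (hc : ∀ (g : G) (h : H), Commute (σ g) (ρ₁ h)) (g : G) (h : H) :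
    Commute ((σ.tprod (1 : Representation k G S₂)) g) ((ρ₁.tprod ρ₂) h) := by
  change (σ.tprod (1 : Representation k G S₂)) g * (ρ₁.tprod ρ₂) h = (ρ₁.tprod ρ₂) h * (σ.tprod (1 : Representation k G S₂)) g
  rw [Representation.tprod_apply, Representation.tprod_apply, MonoidHom.one_apply, ← TensorProduct.map_mul,
    ← TensorProduct.map_mul, (hc g h).eq, one_mul, mul_one]

/-- **`G`-equivariance of `q_ψ`**: for `σ` on `S₁` commuting with `ρ₁`, acting as `σ ⊗ 1`,
`q_ψ (rep χ (σ ⊗ 1) g x) = (rep ψ σ g ⊗ 1) (q_ψ x)`. [cite: GelbartRogawski1991, §3.1 p. 454; Liu2021, proof of Thm. 4.15 (l. 2199–2212)] -/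
theorem coinvTprodQuot_rep (σ : Representation k G S₁) (hc : ∀ (g : G) (h : H), Commute (σ g) (ρ₁ h)) (g : G)
    (x : Coinv (ρ₁.tprod ρ₂) χ) :
    coinvTprodQuot ρ₁ ρ₂ χ ψ (rep χ (σ.tprod (1 : Representation k G S₂)) (commute_tprod_one ρ₁ ρ₂ σ hc) g x) =
      (rep ψ σ hc g).rTensor (Coinv ρ₂ (χ * ψ⁻¹)) (coinvTprodQuot ρ₁ ρ₂ χ ψ x) := by
  obtain ⟨t, rfl⟩ := mk_surjective (ρ₁.tprod ρ₂) χ x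
  rw [rep_mk]
  induction t using TensorProduct.induction_on with
  | zero => simp only [map_zero]
  | tmul v e =>
    rw [Representation.tprod_apply, TensorProduct.map_tmul, MonoidHom.one_apply, Module.End.one_apply,
      coinvTprodQuot_mk_tmul, coinvTprodQuot_mk_tmul, LinearMap.rTensor_tmul, rep_mk]
  | add x y hx hy => simp only [map_add, hx, hy]

/-- **The universal property of `q_ψ`**: a `k`-linear map `f` out of `Coinv (ρ₁ ⊗ ρ₂) χ` on which the
FIRST factor's `H`-action `ρ₁(h) ⊗ 1` (well defined on the coinvariants since it commutes with the diagonal action and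
fixes `χ`'s relation submodule up to the scalar — read on representatives) acts through `ψ`, i.e.
`f (mk ((ρ₁ h ⊗ 1) t)) = ψ h • f (mk t)`, factors through `q_ψ`: `f = f' ∘ q_ψ` for a unique `f'`.
[cite: Liu2021, proof of Thm. 4.15 (l. 2199–2212); App. D §D.1 Step 3 (l. 5219)] -/
theorem coinvTprodQuot_universal {M : Type*} [AddCommGroup M] [Module k M] (f : Coinv (ρ₁.tprod ρ₂) χ →ₗ[k] M)
    (hf : ∀ (h : H) (t : S₁ ⊗[k] S₂),
      f (mk (ρ₁.tprod ρ₂) χ (TensorProduct.map (ρ₁ h) LinearMap.id t)) = ((ψ h : kˣ) : k) • f (mk (ρ₁.tprod ρ₂) χ t)) :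
    ∃! f' : Coinv ρ₁ ψ ⊗[k] Coinv ρ₂ (χ * ψ⁻¹) →ₗ[k] M, f = f' ∘ₗ coinvTprodQuot ρ₁ ρ₂ χ ψ := by
  -- the bilinear map `(mk v, mk e) ↦ f (mk (v ⊗ e))`, well defined in each variable
  -- (1) in `v`: `f (mk (ρ₁ h v ⊗ e)) = ψ h • f (mk (v ⊗ e))` is `hf` on a pure tensor;
  -- (2) in `e`: `f (mk (v ⊗ ρ₂ h e)) = (χψ⁻¹) h • f (mk (v ⊗ e))`, from the diagonal relation
  --     `mk (ρ₁ h v ⊗ ρ₂ h e) = χ h • mk (v ⊗ e)` applied to `ρ₁ h⁻¹ v`, and (1).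
  have h1 : ∀ (h : H) (v : S₁) (e : S₂),
      f (mk (ρ₁.tprod ρ₂) χ (ρ₁ h v ⊗ₜ[k] e)) = ((ψ h : kˣ) : k) • f (mk (ρ₁.tprod ρ₂) χ (v ⊗ₜ[k] e)) := fun h v e => by
    have := hf h (v ⊗ₜ[k] e)
    rwa [TensorProduct.map_tmul, LinearMap.id_apply] at this
  have h2 : ∀ (h : H) (v : S₁) (e : S₂),
      f (mk (ρ₁.tprod ρ₂) χ (v ⊗ₜ[k] ρ₂ h e)) = (((χ * ψ⁻¹) h : kˣ) : k) • f (mk (ρ₁.tprod ρ₂) χ (v ⊗ₜ[k] e)) := by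
    intro h v e
    -- `v ⊗ ρ₂ h e = (ρ₁ ⊗ ρ₂)(h) (ρ₁ h⁻¹ v ⊗ e)`
    have hdiag : v ⊗ₜ[k] ρ₂ h e = (ρ₁.tprod ρ₂) h (ρ₁ h⁻¹ v ⊗ₜ[k] e) := by
      rw [Representation.tprod_apply, TensorProduct.map_tmul, ← Module.End.mul_apply, ← map_mul, mul_inv_cancel,
        map_one, Module.End.one_apply]
    rw [hdiag, mk_ρW, map_smul, h1 h⁻¹, smul_smul, map_inv, MonoidHom.mul_apply, MonoidHom.inv_apply, Units.val_mul]
  -- the descended bilinear map `B (mk v) (mk e) = f (mk (v ⊗ e))`: descend in `e` first (`h2`), then in `v` (`h1`)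
  let b : S₁ →ₗ[k] S₂ →ₗ[k] M := (TensorProduct.mk k S₁ S₂).compr₂ (f ∘ₗ mk (ρ₁.tprod ρ₂) χ)
  have hb : ∀ (v : S₁) (e : S₂), b v e = f (mk (ρ₁.tprod ρ₂) χ (v ⊗ₜ[k] e)) := fun v e => rfl
  have hb₂ : ∀ (h : H) (e : S₂), b.flip (ρ₂ h e) = (((χ * ψ⁻¹) h : kˣ) : k) • b.flip e := fun h e =>
    LinearMap.ext fun v => by
      rw [LinearMap.flip_apply, LinearMap.smul_apply, LinearMap.flip_apply, hb, hb]
      exact h2 h v e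
  let B₁ : Coinv ρ₂ (χ * ψ⁻¹) →ₗ[k] S₁ →ₗ[k] M := lift ρ₂ (χ * ψ⁻¹) b.flip hb₂
  have hB₁ : ∀ (v : S₁) (e : S₂), B₁ (mk ρ₂ (χ * ψ⁻¹) e) v = f (mk (ρ₁.tprod ρ₂) χ (v ⊗ₜ[k] e)) := fun v e => rfl
  have hB₁' : ∀ (h : H) (v : S₁), B₁.flip (ρ₁ h v) = ((ψ h : kˣ) : k) • B₁.flip v := fun h v => by
    refine LinearMap.ext fun y => ?_
    obtain ⟨e, rfl⟩ := mk_surjective ρ₂ (χ * ψ⁻¹) y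
    rw [LinearMap.flip_apply, LinearMap.smul_apply, LinearMap.flip_apply, hB₁, hB₁]
    exact h1 h v e
  let B : Coinv ρ₁ ψ →ₗ[k] Coinv ρ₂ (χ * ψ⁻¹) →ₗ[k] M := lift ρ₁ ψ B₁.flip hB₁'
  have hB : ∀ (v : S₁) (e : S₂), B (mk ρ₁ ψ v) (mk ρ₂ (χ * ψ⁻¹) e) = f (mk (ρ₁.tprod ρ₂) χ (v ⊗ₜ[k] e)) :=
    fun v e => rfl
  refine ⟨TensorProduct.lift B, ?_, ?_⟩
  · refine ext_mk (ρ₁.tprod ρ₂) χ fun t => ?_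
    induction t using TensorProduct.induction_on with
    | zero => simp only [map_zero]
    | tmul v e => rw [LinearMap.comp_apply, coinvTprodQuot_mk_tmul, TensorProduct.lift.tmul, hB]
    | add x y hx hy => simp only [map_add, hx, hy]
  · intro f'' hf''
    refine TensorProduct.ext' fun a b => ?_
    obtain ⟨v, rfl⟩ := mk_surjective ρ₁ ψ a
    obtain ⟨e, rfl⟩ := mk_surjective ρ₂ (χ * ψ⁻¹) b
    rw [TensorProduct.lift.tmul, hB, hf'', LinearMap.comp_apply, coinvTprodQuot_mk_tmul]

end Literature.RepresentationTheory.TwistedCoinv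

end

/-! ## §2. The kernel of `q_ψ` -/

noncomputable section

namespace Literature.RepresentationTheory.TwistedCoinv

open scoped TensorProduct

variable {k : Type*} [CommRing k] {H S₁ S₂ : Type*} [Group H]
  [AddCommGroup S₁] [Module k S₁] [AddCommGroup S₂] [Module k S₂]
  (ρ₁ : Representation k H S₁) (ρ₂ : Representation k H S₂) (χ ψ : H →* kˣ)

/-- `(ρ₁ ⊗ 1)(h)` is `ρ₁ h ⊗ id` as a linear map (private plumbing). [folklore] -/
private theorem tprod_one_apply (h : H) :
    (ρ₁.tprod (1 : Representation k H S₂)) h = TensorProduct.map (ρ₁ h) LinearMap.id := by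
  rw [Representation.tprod_apply, MonoidHom.one_apply, Module.End.one_eq_id]

/-- `q_ψ` kills the `(ρ₁ ⊗ 1, ψ)`-relations: `(ker (ρ₁.tprod 1) ψ).map mk ≤ ker q_ψ`.
[cite: Liu2021, App. D §D.1 Step 3 (l. 5219)] -/
theorem map_ker_tprod_one_le_ker :
    (ker (ρ₁.tprod (1 : Representation k H S₂)) ψ).map (mk (ρ₁.tprod ρ₂) χ) ≤
      LinearMap.ker (coinvTprodQuot ρ₁ ρ₂ χ ψ) := by
  rw [Submodule.map_le_iff_le_comap, ker, Submodule.span_le]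
  rintro _ ⟨⟨h, t⟩, rfl⟩
  rw [SetLike.mem_coe, Submodule.mem_comap, LinearMap.mem_ker, map_sub, map_sub, map_smul, map_smul, sub_eq_zero,
    tprod_one_apply]
  induction t using TensorProduct.induction_on with
  | zero => simp only [map_zero, smul_zero]
  | tmul v e =>
    rw [TensorProduct.map_tmul, LinearMap.id_apply, coinvTprodQuot_mk_tmul, coinvTprodQuot_mk_tmul, mk_ρW,
      TensorProduct.smul_tmul']
  | add x y hx hy => simp only [map_add, smul_add, hx, hy]

/-- **The kernel of `q_ψ`** is the `(ρ₁ ⊗ 1, ψ)`-relation submodule of `S₁ ⊗ S₂` read in the `χ`-coinvariants: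
`ker q_ψ = (ker (ρ₁.tprod 1) ψ).map mk`. [cite: Liu2021, proof of Thm. 4.15 (l. 2199–2212); App. D §D.1 Step 3 (l. 5219)] -/
theorem ker_coinvTprodQuot :
    LinearMap.ker (coinvTprodQuot ρ₁ ρ₂ χ ψ) =
      (ker (ρ₁.tprod (1 : Representation k H S₂)) ψ).map (mk (ρ₁.tprod ρ₂) χ) := by
  refine le_antisymm ?_ (map_ker_tprod_one_le_ker ρ₁ ρ₂ χ ψ)
  set N := (ker (ρ₁.tprod (1 : Representation k H S₂)) ψ).map (mk (ρ₁.tprod ρ₂) χ) with hNdef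
  -- the quotient map by `N` transforms under `ρ₁ ⊗ 1` through `ψ`, so it factors through `q_ψ`
  have hN : ∀ (h : H) (t : S₁ ⊗[k] S₂),
      N.mkQ (mk (ρ₁.tprod ρ₂) χ (TensorProduct.map (ρ₁ h) LinearMap.id t)) =
        ((ψ h : kˣ) : k) • N.mkQ (mk (ρ₁.tprod ρ₂) χ t) := by
    intro h t
    rw [← sub_eq_zero, ← map_smul, ← map_sub, ← map_smul, ← map_sub, Submodule.mkQ_apply,
      Submodule.Quotient.mk_eq_zero, ← tprod_one_apply]
    exact Submodule.mem_map_of_mem (sub_mem_ker (ρ₁.tprod (1 : Representation k H S₂)) ψ h t)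
  obtain ⟨f', hf', -⟩ := coinvTprodQuot_universal ρ₁ ρ₂ χ ψ N.mkQ hN
  intro x hx
  rw [LinearMap.mem_ker] at hx
  have h0 : N.mkQ x = 0 := by rw [hf', LinearMap.comp_apply, hx, map_zero]
  rwa [Submodule.mkQ_apply, Submodule.Quotient.mk_eq_zero] at h0

/-- **The relations upstairs**: the kernel of `mk ⊗ mk : S₁ ⊗ S₂ → Coinv ρ₁ ψ ⊗ Coinv ρ₂ (χψ⁻¹)` is
`R_χ(ρ₁ ⊗ ρ₂) ⊔ R_ψ(ρ₁ ⊗ 1)` — the diagonal `χ`-relations plus the first-factor `ψ`-relations.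
[cite: Liu2021, proof of Thm. 4.15 (l. 2199–2212); App. D §D.1 Step 3 (l. 5219)] -/
theorem ker_map_mk_mk :
    LinearMap.ker (TensorProduct.map (mk ρ₁ ψ) (mk ρ₂ (χ * ψ⁻¹))) =
      ker (ρ₁.tprod ρ₂) χ ⊔ ker (ρ₁.tprod (1 : Representation k H S₂)) ψ := by
  have hk : LinearMap.ker (mk (ρ₁.tprod ρ₂) χ) = ker (ρ₁.tprod ρ₂) χ := Submodule.ker_mkQ _
  rw [← coinvTprodQuot_comp_mk, LinearMap.ker_comp, ker_coinvTprodQuot, Submodule.comap_map_eq, hk, sup_comm]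

/-- **The see-saw quotient as an isomorphism**: `q_ψ` induces
`Coinv (ρ₁ ⊗ ρ₂) χ ⧸ (ker (ρ₁.tprod 1) ψ).map mk ≃ₗ[k] Coinv ρ₁ ψ ⊗ Coinv ρ₂ (χψ⁻¹)`.
[cite: Liu2021, proof of Thm. 4.15 (l. 2199–2212); App. D §D.1 Step 3 (l. 5219)] -/
def coinvTprodQuotKerEquiv :
    (Coinv (ρ₁.tprod ρ₂) χ ⧸ (ker (ρ₁.tprod (1 : Representation k H S₂)) ψ).map (mk (ρ₁.tprod ρ₂) χ)) ≃ₗ[k]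
      Coinv ρ₁ ψ ⊗[k] Coinv ρ₂ (χ * ψ⁻¹) :=
  (Submodule.quotEquivOfEq _ _ (ker_coinvTprodQuot ρ₁ ρ₂ χ ψ).symm).trans
    ((coinvTprodQuot ρ₁ ρ₂ χ ψ).quotKerEquivOfSurjective (coinvTprodQuot_surjective ρ₁ ρ₂ χ ψ))

/-- value of `coinvTprodQuotKerEquiv` on a class: the class of `x` goes to `q_ψ x`. [cite: Liu2021, App. D §D.1 Step 3 (l. 5219)] -/
@[simp] theorem coinvTprodQuotKerEquiv_mk (x : Coinv (ρ₁.tprod ρ₂) χ) :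
    coinvTprodQuotKerEquiv ρ₁ ρ₂ χ ψ (Submodule.Quotient.mk x) = coinvTprodQuot ρ₁ ρ₂ χ ψ x := by
  rw [coinvTprodQuotKerEquiv, LinearEquiv.trans_apply, Submodule.quotEquivOfEq_mk,
    LinearMap.quotKerEquivOfSurjective_apply_mk]

/-- value of `coinvTprodQuotKerEquiv` on generators: the class of `mk (v ⊗ e)` goes to `mk v ⊗ mk e`.
[cite: Liu2021, App. D §D.1 Step 3 (l. 5219)] -/
theorem coinvTprodQuotKerEquiv_mk_mk_tmul (v : S₁) (e : S₂) :
    coinvTprodQuotKerEquiv ρ₁ ρ₂ χ ψ (Submodule.Quotient.mk (mk (ρ₁.tprod ρ₂) χ (v ⊗ₜ[k] e))) =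
      mk ρ₁ ψ v ⊗ₜ[k] mk ρ₂ (χ * ψ⁻¹) e := by
  rw [coinvTprodQuotKerEquiv_mk, coinvTprodQuot_mk_tmul]

/-- the inverse of `coinvTprodQuotKerEquiv` on generators. [cite: Liu2021, App. D §D.1 Step 3 (l. 5219)] -/
theorem coinvTprodQuotKerEquiv_symm_tmul (v : S₁) (e : S₂) :
    (coinvTprodQuotKerEquiv ρ₁ ρ₂ χ ψ).symm (mk ρ₁ ψ v ⊗ₜ[k] mk ρ₂ (χ * ψ⁻¹) e) =
      Submodule.Quotient.mk (mk (ρ₁.tprod ρ₂) χ (v ⊗ₜ[k] e)) := by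
  rw [LinearEquiv.symm_apply_eq, coinvTprodQuotKerEquiv_mk_mk_tmul]


/-! ### The symmetric identity `R_χ(ρ₁ ⊗ ρ₂) ⊔ R_ψ(ρ₁ ⊗ 1) = R_ψ(ρ₁ ⊗ 1) ⊔ R_{χψ⁻¹}(1 ⊗ ρ₂)`
(right-exactness of `⊗`, Mathlib `TensorProduct.map_ker`, plus the identification of the two one-sided relation
submodules with `(ker ρ₁ ψ) ⊗ S₂` and `S₁ ⊗ (ker ρ₂ φ)`). -/

/-- `(1 ⊗ ρ₂)(h)` is `id ⊗ ρ₂ h` as a linear map (private plumbing). [folklore] -/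
private theorem one_tprod_apply (h : H) :
    ((1 : Representation k H S₁).tprod ρ₂) h = TensorProduct.map LinearMap.id (ρ₂ h) := by
  rw [Representation.tprod_apply, MonoidHom.one_apply, Module.End.one_eq_id]

/-- The first-factor relation submodule `R_ψ(ρ₁ ⊗ 1)` is the image of `(ker ρ₁ ψ) ⊗ S₂` in `S₁ ⊗ S₂`.
[cite: Liu2021, App. D §D.1 Step 3 (l. 5219)] -/
theorem range_rTensor_subtype_ker :
    LinearMap.range ((ker ρ₁ ψ).subtype.rTensor S₂) = ker (ρ₁.tprod (1 : Representation k H S₂)) ψ := by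
  rw [LinearMap.rTensor_def, TensorProduct.range_map, Submodule.range_subtype, LinearMap.range_id]
  refine le_antisymm (Submodule.map₂_le.2 fun w hw e _ => ?_) ?_
  · -- `w ⊗ e ∈ R_ψ(ρ₁ ⊗ 1)` for `w ∈ ker ρ₁ ψ`: induct on the span
    rw [TensorProduct.mk_apply]
    revert hw
    refine fun hw => Submodule.span_induction (p := fun w _ => w ⊗ₜ[k] e ∈ ker (ρ₁.tprod (1 : Representation k H S₂)) ψ)
      ?_ ?_ ?_ ?_ hw
    · rintro _ ⟨⟨h, v⟩, rfl⟩
      have e1 : (ρ₁ h v - ((ψ h : kˣ) : k) • v) ⊗ₜ[k] e =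
          (ρ₁.tprod (1 : Representation k H S₂)) h (v ⊗ₜ[k] e) - ((ψ h : kˣ) : k) • (v ⊗ₜ[k] e) := by
        rw [tprod_one_apply, TensorProduct.map_tmul, LinearMap.id_apply, TensorProduct.sub_tmul,
          TensorProduct.smul_tmul']
      rw [e1]
      exact sub_mem_ker _ ψ h _
    · rw [TensorProduct.zero_tmul]; exact Submodule.zero_mem _
    · intro x y _ _ hx hy
      rw [TensorProduct.add_tmul]; exact Submodule.add_mem _ hx hy
    · intro a x _ hx
      rw [← TensorProduct.smul_tmul']; exact Submodule.smul_mem _ a hx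
  · rw [ker, Submodule.span_le]
    rintro _ ⟨⟨h, t⟩, rfl⟩
    rw [SetLike.mem_coe]
    dsimp only
    induction t using TensorProduct.induction_on with
    | zero => rw [map_zero, smul_zero, sub_zero]; exact Submodule.zero_mem _
    | tmul v e =>
      rw [tprod_one_apply, TensorProduct.map_tmul, LinearMap.id_apply, TensorProduct.smul_tmul',
        ← TensorProduct.sub_tmul]
      exact Submodule.apply_mem_map₂ _ (sub_mem_ker ρ₁ ψ h v) Submodule.mem_top
    | add x y hx hy =>
      rw [map_add, smul_add, add_sub_add_comm]
      exact Submodule.add_mem _ hx hy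

/-- The second-factor relation submodule `R_φ(1 ⊗ ρ₂)` is the image of `S₁ ⊗ (ker ρ₂ φ)` in `S₁ ⊗ S₂`.
[cite: Liu2021, App. D §D.1 Step 3 (l. 5219)] -/
theorem range_lTensor_subtype_ker (φ : H →* kˣ) :
    LinearMap.range ((ker ρ₂ φ).subtype.lTensor S₁) = ker ((1 : Representation k H S₁).tprod ρ₂) φ := by
  rw [LinearMap.lTensor_def, TensorProduct.range_map, Submodule.range_subtype, LinearMap.range_id]
  refine le_antisymm (Submodule.map₂_le.2 fun v _ w hw => ?_) ?_
  · rw [TensorProduct.mk_apply]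
    revert hw
    refine fun hw => Submodule.span_induction (p := fun w _ => v ⊗ₜ[k] w ∈ ker ((1 : Representation k H S₁).tprod ρ₂) φ)
      ?_ ?_ ?_ ?_ hw
    · rintro _ ⟨⟨h, e⟩, rfl⟩
      have e1 : v ⊗ₜ[k] (ρ₂ h e - ((φ h : kˣ) : k) • e) =
          ((1 : Representation k H S₁).tprod ρ₂) h (v ⊗ₜ[k] e) - ((φ h : kˣ) : k) • (v ⊗ₜ[k] e) := by
        rw [one_tprod_apply, TensorProduct.map_tmul, LinearMap.id_apply, TensorProduct.tmul_sub,
          TensorProduct.tmul_smul]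
      rw [e1]
      exact sub_mem_ker _ φ h _
    · rw [TensorProduct.tmul_zero]; exact Submodule.zero_mem _
    · intro x y _ _ hx hy
      rw [TensorProduct.tmul_add]; exact Submodule.add_mem _ hx hy
    · intro a x _ hx
      rw [TensorProduct.tmul_smul]; exact Submodule.smul_mem _ a hx
  · rw [ker, Submodule.span_le]
    rintro _ ⟨⟨h, t⟩, rfl⟩
    rw [SetLike.mem_coe]
    dsimp only
    induction t using TensorProduct.induction_on with
    | zero => rw [map_zero, smul_zero, sub_zero]; exact Submodule.zero_mem _
    | tmul v e =>
      rw [one_tprod_apply, TensorProduct.map_tmul, LinearMap.id_apply, ← TensorProduct.tmul_smul,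
        ← TensorProduct.tmul_sub]
      exact Submodule.apply_mem_map₂ _ Submodule.mem_top (sub_mem_ker ρ₂ φ h e)
    | add x y hx hy =>
      rw [map_add, smul_add, add_sub_add_comm]
      exact Submodule.add_mem _ hx hy

/-- **The symmetric identity** `R_χ(ρ₁ ⊗ ρ₂) ⊔ R_ψ(ρ₁ ⊗ 1) = R_ψ(ρ₁ ⊗ 1) ⊔ R_{χψ⁻¹}(1 ⊗ ρ₂)` in `S₁ ⊗ S₂`: modulo
the first-factor `ψ`-relations, the diagonal `χ`-relations are the second-factor `χψ⁻¹`-relations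
(from `ker_map_mk_mk` and right-exactness of `⊗`).
[cite: Liu2021, proof of Thm. 4.15 (l. 2199–2212); App. D §D.1 Step 3 (l. 5219)] -/
theorem ker_tprod_sup_ker_tprod_one :
    ker (ρ₁.tprod ρ₂) χ ⊔ ker (ρ₁.tprod (1 : Representation k H S₂)) ψ =
      ker (ρ₁.tprod (1 : Representation k H S₂)) ψ ⊔ ker ((1 : Representation k H S₁).tprod ρ₂) (χ * ψ⁻¹) := by
  have h1 : Function.Exact (ker ρ₁ ψ).subtype (mk ρ₁ ψ) := LinearMap.exact_subtype_mkQ _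
  have h2 : Function.Exact (ker ρ₂ (χ * ψ⁻¹)).subtype (mk ρ₂ (χ * ψ⁻¹)) := LinearMap.exact_subtype_mkQ _
  rw [← ker_map_mk_mk, TensorProduct.map_ker h1 (mk_surjective ρ₁ ψ) h2 (mk_surjective ρ₂ (χ * ψ⁻¹)),
    range_lTensor_subtype_ker, range_rTensor_subtype_ker, sup_comm]

end Literature.RepresentationTheory.TwistedCoinv

end
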